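import Literature.AlgebraicGeometry.Resolution.BoundaryRestriction
import Literature.AlgebraicGeometry.Resolution.RegularBlowup
import Literature.AlgebraicGeometry.Resolution.HypersurfaceTransform
import Literature.AlgebraicGeometry.Resolution.BlowupSequencesAppend
import HarnessLib

/-!
# Crux `PatchingRelPerfect` (stmt-ResolutionOfSingularities-16161), chain W5.2 — F7(β) (β-AX) X3 C-I finish, CE1
# `…DepthPhaseCCarrierGameLift`, part 3 (PUSH-FORWARD): GOING UP AT MULTIPLICITY ONE ALONG A CARRIER

[OURS · L1 W5.2 · res-L1-w52-plan-1 NOTE G11-40 (3) / G11-49 (2) / RULING G12-1 (7) → res-D-pv-046; design of record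
`D/res-D-pv-046/DepthPhaseCCarrierGameLift.scratch.v2.lean` (P3)] Replaces the role of NO printed item; NOT a statement of the
manuscript under review; fact-free; any dimension.

Kollár's going-up (Lectures 2007, Thm. 3.84 / Cor. 3.85; BGMW arXiv:1206.3090 Lemma 3.9.4 (2)–(3)) in the degenerate case of
MULTIPLICITY ONE, where a "hypersurface of maximal contact" for `(X, 𝓘, 1)` is a regular hypersurface `S = V(ker j) ⊆ V(𝓘)`, i.e.
a CARRIER `ker j ⊆ 𝓘`, and no differential calculus is needed (the tree's `CoefficientIdealGoingUp.lean` is the `μ`-general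
version WITH a `k`-structure; this file is its `μ = 1` twin WITHOUT one, for arbitrary regular locally Noetherian `X`).
Along a closed immersion `j : S ↪ X` onto a regular hypersurface of a regular `X` we carry, for marked ideals `M = (𝓘, E_X, 1)`
on `X` and `N = (𝓘|_S, E_S, 1)` on `S`: `N.ideal = j^* M.ideal`; a SUB-boundary `E'_S ⊆ E_S` related to `E_X` along `j`
(`BoundaryRel`, Kollár's "`E|_H`"; the members of `E_S` outside `E'_S` — e.g. letters living only on the carrier — are ignored
on `X`, admissibility on `S` being stronger); and the carrier condition `ker j ⊆ M.ideal`.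

* `support_eq_preimage`, `admissible_map` — `supp N = j⁻¹ supp M`; an admissible centre `Z` for `N` pushes forward to the
  admissible centre `j_* Z` for `M` (BGMW Lemma 3.9.4 (3), one step, `μ = 1`).
* `transform` — the data persist along Kollár's embedding `j₁ : Bl_Z S ↪ Bl_{j_* Z} X` (`blowup.pushforwardMap`):
  `ker j₁ = (π^* ker j : 𝓘(D))` (`blowup.ker_pushforwardMap`) has order-one generators
  (`IsBlowup.exists_generator_notMem_sq_controlledTransform`), stays inside the transformed ideal (`colon_mono_left`), the ideals
  restrict (`comap_pushforwardMap_controlledTransform`), the boundaries stay related (`BoundaryRel.transform`).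
* `centreSeq_goingUp` — iterated along a `CentreSeq` on `S` (Kollár 3.30.3 `CentreSeq.pushforward`): `t` admissible for `N`
  ⟹ `j_* t` admissible for `M`, regular top, `(N)_r = j_r^*(M)_r`, `ker j_r ⊆ (M)_r`.
* **`isAdmissibleFor_pushforward_and_ideal_eq_top`** — if moreover `t` makes `(N)_r` the UNIT ideal, then `(M)_r` is the unit
  ideal (`j_{r*} j_r^* (M)_r = (M)_r` as `ker j_r ⊆ (M)_r`, `map_comap_of_ker_le`): Kollár 3.104 Step 2.2 at `μ = 1`.
* `exists_isEffectiveCartier_mul_transformMarked_ideal` — along any admissible sequence, `Π^* 𝓘 = 𝓔 · 𝓘_r` with `𝓔`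
  EFFECTIVE CARTIER (the accumulated exceptional monomial; `MarkedIdeal.pow_mul_transform_ideal` stage by stage) — the tree's
  `IsMultipleBlowup.exists_comap_eq_mul` with "locally principal" sharpened to "effective Cartier".

AI-written; AI review is weaker than expert review.

## References (for the mathematics; nothing here is a statement of the manuscript under review)
* J. Kollár, *Lectures on Resolution of Singularities* (2007), 3.30.3, Thm. 3.84, Cor. 3.85, 3.104 Step 2.2, 3.72. [Kollar2007]
* E. Bierstone, D. Grigoriev, P. Milman, J. Włodarczyk, arXiv:1206.3090, Lemma 3.9.4, Lemma 3.2.1. [BierstoneGrigorievMilmanWlodarczyk2011]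
-/

-- `Summit.<Summit>.<Sub>.Theorems` with `Sub = Summit` (single-conjunct summit, D-0017)
set_option linter.dupNamespace false

noncomputable section

open CategoryTheory AlgebraicGeometry TopologicalSpace IsLocalRing
open Literature.AlgebraicGeometry.Resolution

namespace Summit.ResolutionOfSingularities.ResolutionOfSingularities.Theorems

namespace CarrierGoingUp

universe u

variable {S X : Scheme.{u}}

/-! ## One stage: supports and admissible centres -/

/-- At multiplicity one with `N.ideal = j^* M.ideal`: `supp N = j⁻¹ supp M` (both supports are the zero sets).
[cite: BierstoneGrigorievMilmanWlodarczyk2011, Lemma 3.9.4 (2)] -/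
theorem support_eq_preimage (j : S ⟶ X) {M : MarkedIdeal X} {N : MarkedIdeal S}
    (hI : N.ideal = M.ideal.comap j) (hMm : M.mult = 1) (hNm : N.mult = 1) :
    N.support = j ⁻¹' M.support := by
  rw [N.support_of_mult_eq_one hNm, M.support_of_mult_eq_one hMm, hI, Scheme.IdealSheafData.support_comap]
  rfl

/-- **An admissible centre on `S` pushes forward to an admissible centre on `X`** (inside the support, simple normal
crossings with the boundary — lifted through the related sub-boundary —, regular). [cite: BierstoneGrigorievMilmanWlodarczyk2011, Lemma 3.9.4 (3)]
[cite: Kollar2007, Cor. 3.85] -/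
theorem admissible_map (j : S ⟶ X) [IsClosedImmersion j] {M : MarkedIdeal X} {N : MarkedIdeal S}
    (hI : N.ideal = M.ideal.comap j) (hMm : M.mult = 1) (hNm : N.mult = 1)
    {BS' : List S.IdealSheafData} (hsub : BS'.Sublist N.boundary) (hB : BoundaryRel j M.boundary BS')
    {Z : S.IdealSheafData} (hsupp : (Z.support : Set S) ⊆ N.support) (hsnc : HasSNCWith N.boundary Z)
    (hZ : Scheme.IsRegular Z.subscheme) :
    ((Z.map j).support : Set X) ⊆ M.support ∧ HasSNCWith M.boundary (Z.map j) ∧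
      Scheme.IsRegular (Z.map j).subscheme := by
  refine ⟨?_, (hB.hasSNCWith_map j (hsnc.sublist hsub)).of_cons,
    (isRegular_subscheme_map_iff_of_isClosedImmersion j Z).mpr hZ⟩
  intro x hx
  rw [coe_support_map_of_isClosedImmersion] at hx
  obtain ⟨s, hs, rfl⟩ := hx
  have h1 := hsupp hs
  rw [support_eq_preimage j hI hMm hNm] at h1
  exact h1

/-! ## One blow-up: the data persist along `j₁ : Bl_Z S ↪ Bl_{j_* Z} X` -/

/-- **Persistence under one blow-up of the push-forward** (`μ = 1` twin of the tree's `GoingUpInv.transform`): regularity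
upstairs, order-one generators of `ker j₁ = (π^* ker j : 𝓘(D))`, `N₁.ideal = j₁^* M₁.ideal`, multiplicities, the related
sub-boundary, and the carrier condition `ker j₁ ⊆ M₁.ideal`. [cite: Kollar2007, 3.30.3, Cor. 3.85 (proof)]
[cite: BierstoneGrigorievMilmanWlodarczyk2011, Lemma 3.9.4 (2)–(3)] -/
theorem transform [IsLocallyNoetherian X] [IsLocallyNoetherian S] (j : S ⟶ X) [IsClosedImmersion j]
    {M : MarkedIdeal X} {N : MarkedIdeal S} (hX : Scheme.IsRegular X)
    (hH : ∀ x ∈ j.ker.support, ∃ v : X.presheaf.stalk x,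
      stalkIdeal j.ker x = Ideal.span {v} ∧ v ∉ (maximalIdeal (X.presheaf.stalk x)) ^ 2)
    (hI : N.ideal = M.ideal.comap j) (hMm : M.mult = 1) (hNm : N.mult = 1)
    {BS' : List S.IdealSheafData} (hsub : BS'.Sublist N.boundary) (hB : BoundaryRel j M.boundary BS')
    (hker : j.ker ≤ M.ideal)
    {Z : S.IdealSheafData} (hsupp : (Z.support : Set S) ⊆ N.support) (hsnc : HasSNCWith N.boundary Z)
    (hZ : Scheme.IsRegular Z.subscheme) :
    Scheme.IsRegular (blowup (Z.map j)) ∧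
    (∀ x ∈ (blowup.pushforwardMap Z j).ker.support, ∃ v : (blowup (Z.map j)).presheaf.stalk x,
      stalkIdeal (blowup.pushforwardMap Z j).ker x = Ideal.span {v} ∧
        v ∉ (maximalIdeal ((blowup (Z.map j)).presheaf.stalk x)) ^ 2) ∧
    (N.transform (blowup.π Z) Z).ideal =
      (M.transform (blowup.π (Z.map j)) (Z.map j)).ideal.comap (blowup.pushforwardMap Z j) ∧
    (M.transform (blowup.π (Z.map j)) (Z.map j)).mult = 1 ∧ (N.transform (blowup.π Z) Z).mult = 1 ∧
    (∃ BS'₁ : List (blowup Z).IdealSheafData, BS'₁.Sublist (N.transform (blowup.π Z) Z).boundary ∧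
      BoundaryRel (blowup.pushforwardMap Z j) (M.transform (blowup.π (Z.map j)) (Z.map j)).boundary BS'₁) ∧
    (blowup.pushforwardMap Z j).ker ≤ (M.transform (blowup.π (Z.map j)) (Z.map j)).ideal := by
  obtain ⟨hsuppX, hsncX, hZX⟩ := admissible_map j hI hMm hNm hsub hB hsupp hsnc hZ
  haveI : IsLocallyNoetherian (blowup (Z.map j)) := CentreSeq.isLocallyNoetherian_blowup _
  haveI : IsLocallyNoetherian (blowup Z) := CentreSeq.isLocallyNoetherian_blowup Z
  have hπ : IsBlowup (blowup.π (Z.map j)) (Z.map j) := blowup.isBlowup _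
  have hHC : j.ker ≤ Z.map j := ker_le_map Z j
  have hker₁ : (blowup.pushforwardMap Z j).ker =
      controlledTransform (blowup.π (Z.map j)) (Z.map j) j.ker 1 :=
    blowup.ker_pushforwardMap j Z hX hZX hH
  have hJ : M.ideal.comap (blowup.π (Z.map j)) ≤ (Z.map j).comap (blowup.π (Z.map j)) ^ 1 := by
    have h := M.comap_ideal_le_pow hsuppX hsncX (blowup.π (Z.map j))
    rwa [hMm] at h
  refine ⟨hπ.isRegular_of_isRegular_subscheme hX hZX, ?_, ?_, hMm, hNm, ?_, ?_⟩
  · rw [hker₁]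
    exact hπ.exists_generator_notMem_sq_controlledTransform hX hZX hHC hH
  · rw [MarkedIdeal.transform_ideal, MarkedIdeal.transform_ideal, hI, hNm, hMm,
      comap_pushforwardMap_controlledTransform Z j hJ]
  · refine ⟨BS'.map (strictTransformIdeal (blowup.π Z) Z) ++ [Z.comap (blowup.π Z)], ?_, ?_⟩
    · rw [MarkedIdeal.transform_boundary]
      exact (hsub.map _).append (List.Sublist.refl _)
    · rw [MarkedIdeal.transform_boundary]
      exact hB.transform j hX hH hZX (hsnc.sublist hsub)
  · rw [hker₁, MarkedIdeal.transform_ideal, hMm]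
    exact colon_mono_left (Scheme.IdealSheafData.comap_mono (f := blowup.π (Z.map j)) hker) _

/-! ## Along a blow-up sequence -/

/-- **Going up at multiplicity one along a blow-up sequence** (Kollár Thm. 3.84 / Cor. 3.85 (1) ⇒ (2) at `m = 1`, BGMW
Lemma 3.9.4 (3) iterated; the tree's `CentreSeq.goingUp` without differential structure): with the data above at the stage
`j : S ↪ X`, every `t : CentreSeq S` admissible for `N` pushes forward (Kollár 3.30.3) to `j_* t` admissible for `M`, with
regular top, `(N)_r = j_r^* (M)_r` and `ker j_r ⊆ (M)_r` along the last embedding `j_r`.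
[cite: Kollar2007, Thm. 3.84, Cor. 3.85, 3.30.3] [cite: BierstoneGrigorievMilmanWlodarczyk2011, Lemma 3.9.4 (2)–(3)] -/
theorem centreSeq_goingUp : ∀ {S X : Scheme.{u}} [IsLocallyNoetherian X] [IsLocallyNoetherian S]
    (t : CentreSeq S) (j : S ⟶ X) [IsClosedImmersion j] (M : MarkedIdeal X) (N : MarkedIdeal S),
    Scheme.IsRegular X →
    (∀ x ∈ j.ker.support, ∃ v : X.presheaf.stalk x,
      stalkIdeal j.ker x = Ideal.span {v} ∧ v ∉ (maximalIdeal (X.presheaf.stalk x)) ^ 2) →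
    N.ideal = M.ideal.comap j → M.mult = 1 → N.mult = 1 →
    (∃ BS' : List S.IdealSheafData, BS'.Sublist N.boundary ∧ BoundaryRel j M.boundary BS') →
    j.ker ≤ M.ideal → t.IsAdmissibleFor N →
    (t.pushforward j).IsAdmissibleFor M ∧ Scheme.IsRegular (t.pushforward j).top ∧
      (t.transformMarked N).ideal =
        ((t.pushforward j).transformMarked M).ideal.comap (t.pushforwardι j) ∧
      (t.pushforwardι j).ker ≤ ((t.pushforward j).transformMarked M).ideal
  | _, _, _, _, CentreSeq.nil _, j, _, M, N, hX, _, hI, _, _, _, hker, _ => ⟨trivial, hX, hI, hker⟩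
  | _, _, _, _, CentreSeq.cons Z rest, j, _, M, N, hX, hH, hI, hMm, hNm, ⟨BS', hsub, hB⟩, hker, hadm => by
    obtain ⟨hsupp, hsnc, hZ, hrest⟩ := hadm
    haveI : IsLocallyNoetherian (blowup (Z.map j)) := CentreSeq.isLocallyNoetherian_blowup _
    haveI : IsLocallyNoetherian (blowup Z) := CentreSeq.isLocallyNoetherian_blowup Z
    obtain ⟨hsuppX, hsncX, hZX⟩ := admissible_map j hI hMm hNm hsub hB hsupp hsnc hZ
    obtain ⟨hX₁, hH₁, hI₁, hMm₁, hNm₁, hB₁, hker₁⟩ :=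
      transform j hX hH hI hMm hNm hsub hB hker hsupp hsnc hZ
    obtain ⟨hadm₁, htop₁, hI', hker'⟩ := centreSeq_goingUp rest (blowup.pushforwardMap Z j) _ _
      hX₁ hH₁ hI₁ hMm₁ hNm₁ hB₁ hker₁ hrest
    exact ⟨⟨hsuppX, hsncX, hZX, hadm₁⟩, htop₁, hI', hker'⟩

/-- **Kollár 3.104 Step 2.2 at multiplicity one: a sequence on the carrier making the restricted ideal the UNIT ideal pushes
forward to a sequence making the ideal the UNIT ideal** — with the data above, if `t` is admissible for `N` and `(N)_r = 𝒪`,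
then `j_* t` is admissible for `M`, has regular top, and `(M)_r = 𝒪` (`ker j_r ⊆ (M)_r` and `j_r^*(M)_r = (N)_r = 𝒪`, so
`(M)_r = j_{r*} j_r^* (M)_r = j_{r*} 𝒪 = 𝒪`). [cite: Kollar2007, 3.104 Step 2.2, Cor. 3.85]
[cite: BierstoneGrigorievMilmanWlodarczyk2011, Lemma 3.9.4 (3)] -/
theorem isAdmissibleFor_pushforward_and_ideal_eq_top [IsLocallyNoetherian X] [IsLocallyNoetherian S]
    (t : CentreSeq S) (j : S ⟶ X) [IsClosedImmersion j] (M : MarkedIdeal X) (N : MarkedIdeal S)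
    (hX : Scheme.IsRegular X)
    (hH : ∀ x ∈ j.ker.support, ∃ v : X.presheaf.stalk x,
      stalkIdeal j.ker x = Ideal.span {v} ∧ v ∉ (maximalIdeal (X.presheaf.stalk x)) ^ 2)
    (hI : N.ideal = M.ideal.comap j) (hMm : M.mult = 1) (hNm : N.mult = 1)
    (hB : ∃ BS' : List S.IdealSheafData, BS'.Sublist N.boundary ∧ BoundaryRel j M.boundary BS')
    (hker : j.ker ≤ M.ideal) (hadm : t.IsAdmissibleFor N) (htop : (t.transformMarked N).ideal = ⊤) :
    (t.pushforward j).IsAdmissibleFor M ∧ Scheme.IsRegular (t.pushforward j).top ∧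
      ((t.pushforward j).transformMarked M).ideal = ⊤ := by
  obtain ⟨hadm', hreg, hI', hker'⟩ := centreSeq_goingUp t j M N hX hH hI hMm hNm hB hker hadm
  haveI := CentreSeq.isClosedImmersion_pushforwardι t j
  refine ⟨hadm', hreg, ?_⟩
  rw [← map_comap_of_ker_le _ (t.pushforwardι j) hker', ← hI', htop]
  exact (map_eq_top_iff_of_isClosedImmersion (t.pushforwardι j) ⊤).mpr rfl

/-! ## The accumulated exceptional monomial -/

/-- **`Π^* 𝓘 = 𝓔 · 𝓘_r` with `𝓔` effective Cartier** along any admissible sequence for `M = (𝓘, E, μ)` (locally Noetherian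
`X`): stage by stage `π^* 𝓘_i = 𝓘(D)^μ · 𝓘_{i+1}` (`MarkedIdeal.pow_mul_transform_ideal`) and exceptional divisors pull back
to effective Cartier divisors up the tower (`IsEffectiveCartier.comap_centreSeqComp`). [cite: Kollar2007, 3.72]
[cite: BierstoneGrigorievMilmanWlodarczyk2011, Lemma 3.2.1] -/
theorem exists_isEffectiveCartier_mul_transformMarked_ideal :
    ∀ {X : Scheme.{u}} [IsLocallyNoetherian X] (s : CentreSeq X) (M : MarkedIdeal X), s.IsAdmissibleFor M →
      ∃ E : s.top.IdealSheafData, IsEffectiveCartier E ∧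
        M.ideal.comap s.comp = E * (s.transformMarked M).ideal
  | X, _, CentreSeq.nil _, M, _ =>
    ⟨⊤, isEffectiveCartier_top, by
      show M.ideal.comap (𝟙 X) = ⊤ * M.ideal
      rw [Scheme.IdealSheafData.comap_id, ← Scheme.IdealSheafData.one_eq_top, one_mul]⟩
  | X, _, CentreSeq.cons C rest, M, hadm => by
    obtain ⟨hsupp, hsnc, -, hrest⟩ := hadm
    haveI : IsLocallyNoetherian (blowup C) := CentreSeq.isLocallyNoetherian_blowup C
    obtain ⟨E, hE, hEq⟩ := exists_isEffectiveCartier_mul_transformMarked_ideal rest _ hrest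
    refine ⟨((C.comap (blowup.π C)) ^ M.mult).comap rest.comp * E,
      (((blowup.isBlowup C).isEffectiveCartier.pow M.mult).comap_centreSeqComp rest).mul hE, ?_⟩
    show M.ideal.comap (rest.comp ≫ blowup.π C) =
      ((C.comap (blowup.π C)) ^ M.mult).comap rest.comp * E *
        (rest.transformMarked (M.transform (blowup.π C) C)).ideal
    rw [Scheme.IdealSheafData.comap_comp, ← M.pow_mul_transform_ideal (blowup.π C) hsupp hsnc (blowup.isBlowup C),
      comap_mul, hEq, mul_assoc]

end CarrierGoingUp

end Summit.ResolutionOfSingularities.ResolutionOfSingularities.Theorems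

end
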